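import Mathlib.Tactic.NormNum.Prime
import Summits.MatrixMultiplication.OmegaCensus.PowBox

/-!
# ω-census, family (b3): conjecture C9 (b) — prescribed-power certificates for the primes `3, 7, 13, 19` and `2`

HONEST FRAMING (pub-omega census; verbatim): lottery ticket; floor = certified bounds/negative ranges.
Census BOOKKEEPING (conjecture C9 of the cell, STRUCTURE.md §2, `BoxRatioSectionLaw`; pub-omega stpp-1 gen 23, the atom lane).
Nothing here is progress on `ω`.

`TwoGenBoxMain` serves every prime `p ≥ 5` except `7, 13, 19` from TWO prescribed powers `x, u x`; the two-generator family
provably cannot reach density `9/5` for `p ∈ {7, 13, 19}` and cannot even be set up for `p = 2, 3`.  Here the remaining primes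
get certificates with THREE prescribed powers `x, u x, u² x` (`p = 3, 7, 13, 19`; one-dimensional, `P = 𝔽_p`, found by exact
maximum-independent-set search and re-verified in honest rings `𝔽_p[X]/(X^q − 1)`, seat code `code/gen_search.py`,
`code/verify_ring.py`) and FOUR prescribed powers for `p = 2` (`P = 𝔽_2²`; with three powers the best patterns found reach
`7/36` and `14/72`, one short).  Sizes: `p = 3`: `6/27`; `p = 7`: `14/63`; `p = 13`: `27/117`; `p = 19`: `40/171`; `p = 2`:
`8/36` — in each case `5·Σ_c #A_c ≥ 9|P|`.  Each theorem `not_boxUseful_p` says: for every finite commutative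
ring `R`, `u ∈ R` with `u ^ q = 1`, and `x ∈ R` such that every value vector on `x, u x, …, u^E x` (`E = 2`, resp. `3` for
`p = 2`) is realised by an additive `λ : R → 𝔽_p` (i.e. these powers are `𝔽_p`-linearly independent — automatic for the Schmidt
atoms `𝔽_{p^k} ⋊ μ_q` with `k ≥ E + 1`): `¬ BoxUseful (R ⋊_u ℤ/q)`.  The separation and counting side conditions are closed
by `decide`.
-/

namespace Summit.MatrixMultiplication.OmegaCensus

open Finset ProductBoxBound

namespace PowBox

variable {R : Type*} [CommRing R] [Fintype R] [DecidableEq R] {q : ℕ} [NeZero q] {u : R} [Fact (u ^ q = 1)]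

/-! ### `p = 3`: shape `ea = (0, 1, 1)`, `eb = (0, 1, 1)`, `m = (2, 0, 1)`, `n = (0, 2, 1)`, `s = (1, 1, 0)`, pattern `6/27` -/

/-- The shape for `p = 3`. [folklore] -/
def shape3 : Shape := ⟨![0, 1, 1], ![0, 1, 1], ![2, 0, 1], ![0, 2, 1]⟩

/-- The prescribed values `λ (u^e x)`, `e ≤ 2`, for `p = 3`. [folklore] -/
def s3 (e : ℕ) : ZMod 3 := if e = 0 then 1 else if e = 1 then 1 else 0

/-- The nine column sets for `p = 3` (total `6`). [folklore] -/
def A3 (c : Fin 3 × Fin 3) : Finset (ZMod 3) :=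
  (![![{0}, ∅, {1}], ![∅, {2}, {0}], ![{2}, {1}, ∅]] : Fin 3 → Fin 3 → Finset (ZMod 3)) c.1 c.2

/-- Separation for `p = 3` (by `decide`). [folklore] -/
theorem sep3 : ∀ c c' : Fin 3 × Fin 3, c ≠ c' → ∀ z ∈ A3 c, ∀ z' ∈ A3 c', z - z' ≠ shape3.delta s3 c c' := by
  decide +kernel

/-- Count for `p = 3`: `9·3 ≤ 5·6`. [folklore] -/
theorem big3 : 9 * Fintype.card (ZMod 3) ≤ 5 * ∑ c, #(A3 c) := by
  rw [ZMod.card]; decide +kernel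

/-- Exponent bound and separating criterion of the shape for `p = 3` (by `decide`). [folklore] -/
theorem crit3 : (∀ i j : Fin 3, shape3.ea i + shape3.eb j ≤ 2) ∧
    (∀ i i' : Fin 3, i ≠ i' → shape3.ea i ≠ shape3.ea i' ∨ ¬ (3 : ℤ) ∣ shape3.m i - shape3.m i') ∧
    (∀ j j' : Fin 3, j ≠ j' → shape3.eb j ≠ shape3.eb j' ∨ ¬ (3 : ℤ) ∣ shape3.n j - shape3.n j') := by
  decide +kernel

/-- **`p = 3`.** `R ⋊_u ℤ/q` is not box-useful whenever `x, u x, u² x` carry every prescribed additive `𝔽_3`-valued functional.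
[folklore] -/
theorem not_boxUseful_3 (x : R) (hfun : ∀ t : ℕ → ZMod 3, ∃ lam : R →+ ZMod 3, ∀ e, e ≤ 2 → lam (u ^ e * x) = t e) :
    ¬ BoxUseful (RCyc R q u) := by
  have hs0 : s3 0 ≠ 0 := by decide
  haveI : Fact (Nat.Prime 3) := ⟨by norm_num⟩
  obtain ⟨⟨lam, hlam⟩, ⟨lam1, h1⟩⟩ := fun_data hfun s3
  have hs : lam (u ^ 0 * x) ≠ 0 := by rw [hlam 0 (by norm_num)]; exact hs0
  exact shape3.not_boxUseful crit3.1 (lt_q_of_fun hfun) x lam (surjective_of_ne_zero lam _ hs) s3 hlam lam1 h1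
    crit3.2.1 crit3.2.2 A3 sep3 big3

/-! ### `p = 7`: shape `ea = (0, 1, 1)`, `eb = (0, 1, 1)`, `m = (0, 3, 5)`, `n = (4, 0, 6)`, `s = (1, 5, 0)`, pattern `14/63` -/

/-- The shape for `p = 7`. [folklore] -/
def shape7 : Shape := ⟨![0, 1, 1], ![0, 1, 1], ![0, 3, 5], ![4, 0, 6]⟩

/-- The prescribed values `λ (u^e x)`, `e ≤ 2`, for `p = 7`. [folklore] -/
def s7 (e : ℕ) : ZMod 7 := if e = 0 then 1 else if e = 1 then 5 else 0

/-- The nine column sets for `p = 7` (total `14`). [folklore] -/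
def A7 (c : Fin 3 × Fin 3) : Finset (ZMod 7) :=
  (![![{2, 5}, {0}, {0, 1}], ![{0, 3}, {4, 5}, {3}], ![∅, {1, 2}, {0, 6}]] : Fin 3 → Fin 3 → Finset (ZMod 7)) c.1 c.2

/-- Separation for `p = 7` (by `decide`). [folklore] -/
theorem sep7 : ∀ c c' : Fin 3 × Fin 3, c ≠ c' → ∀ z ∈ A7 c, ∀ z' ∈ A7 c', z - z' ≠ shape7.delta s7 c c' := by
  decide +kernel

/-- Count for `p = 7`: `9·7 ≤ 5·14`. [folklore] -/
theorem big7 : 9 * Fintype.card (ZMod 7) ≤ 5 * ∑ c, #(A7 c) := by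
  rw [ZMod.card]; decide +kernel

/-- Exponent bound and separating criterion of the shape for `p = 7` (by `decide`). [folklore] -/
theorem crit7 : (∀ i j : Fin 3, shape7.ea i + shape7.eb j ≤ 2) ∧
    (∀ i i' : Fin 3, i ≠ i' → shape7.ea i ≠ shape7.ea i' ∨ ¬ (7 : ℤ) ∣ shape7.m i - shape7.m i') ∧
    (∀ j j' : Fin 3, j ≠ j' → shape7.eb j ≠ shape7.eb j' ∨ ¬ (7 : ℤ) ∣ shape7.n j - shape7.n j') := by
  decide +kernel

/-- **`p = 7`.** `R ⋊_u ℤ/q` is not box-useful whenever `x, u x, u² x` carry every prescribed additive `𝔽_7`-valued functional.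
[folklore] -/
theorem not_boxUseful_7 (x : R) (hfun : ∀ t : ℕ → ZMod 7, ∃ lam : R →+ ZMod 7, ∀ e, e ≤ 2 → lam (u ^ e * x) = t e) :
    ¬ BoxUseful (RCyc R q u) := by
  have hs0 : s7 0 ≠ 0 := by decide
  haveI : Fact (Nat.Prime 7) := ⟨by norm_num⟩
  obtain ⟨⟨lam, hlam⟩, ⟨lam1, h1⟩⟩ := fun_data hfun s7
  have hs : lam (u ^ 0 * x) ≠ 0 := by rw [hlam 0 (by norm_num)]; exact hs0
  exact shape7.not_boxUseful crit7.1 (lt_q_of_fun hfun) x lam (surjective_of_ne_zero lam _ hs) s7 hlam lam1 h1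
    crit7.2.1 crit7.2.2 A7 sep7 big7

/-! ### `p = 13`: shape `ea = (0, 0, 1)`, `eb = (0, 1, 1)`, `m = (7, 5, 1)`, `n = (5, 12, 2)`, `s = (4, 0, 1)`, pattern `27/117` -/

/-- The shape for `p = 13`. [folklore] -/
def shape13 : Shape := ⟨![0, 0, 1], ![0, 1, 1], ![7, 5, 1], ![5, 12, 2]⟩

/-- The prescribed values `λ (u^e x)`, `e ≤ 2`, for `p = 13`. [folklore] -/
def s13 (e : ℕ) : ZMod 13 := if e = 0 then 4 else if e = 1 then 0 else 1

/-- The nine column sets for `p = 13` (total `27`). [folklore] -/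
def A13 (c : Fin 3 × Fin 3) : Finset (ZMod 13) :=
  (![![{0, 4, 8}, {2, 7, 11}, {3, 4, 8, 12}], ![{0, 4, 10}, {0, 5, 9}, {1, 6, 10}], ![{2, 11}, {4, 8, 12}, {0, 4, 8}]] : Fin 3 → Fin 3 → Finset (ZMod 13)) c.1 c.2

/-- Separation for `p = 13` (by `decide`). [folklore] -/
theorem sep13 : ∀ c c' : Fin 3 × Fin 3, c ≠ c' → ∀ z ∈ A13 c, ∀ z' ∈ A13 c', z - z' ≠ shape13.delta s13 c c' := by
  decide +kernel

/-- Count for `p = 13`: `9·13 ≤ 5·27`. [folklore] -/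
theorem big13 : 9 * Fintype.card (ZMod 13) ≤ 5 * ∑ c, #(A13 c) := by
  rw [ZMod.card]; decide +kernel

/-- Exponent bound and separating criterion of the shape for `p = 13` (by `decide`). [folklore] -/
theorem crit13 : (∀ i j : Fin 3, shape13.ea i + shape13.eb j ≤ 2) ∧
    (∀ i i' : Fin 3, i ≠ i' → shape13.ea i ≠ shape13.ea i' ∨ ¬ (13 : ℤ) ∣ shape13.m i - shape13.m i') ∧
    (∀ j j' : Fin 3, j ≠ j' → shape13.eb j ≠ shape13.eb j' ∨ ¬ (13 : ℤ) ∣ shape13.n j - shape13.n j') := by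
  decide +kernel

/-- **`p = 13`.** `R ⋊_u ℤ/q` is not box-useful whenever `x, u x, u² x` carry every prescribed additive `𝔽_13`-valued functional.
[folklore] -/
theorem not_boxUseful_13 (x : R) (hfun : ∀ t : ℕ → ZMod 13, ∃ lam : R →+ ZMod 13, ∀ e, e ≤ 2 → lam (u ^ e * x) = t e) :
    ¬ BoxUseful (RCyc R q u) := by
  have hs0 : s13 0 ≠ 0 := by decide
  haveI : Fact (Nat.Prime 13) := ⟨by norm_num⟩
  obtain ⟨⟨lam, hlam⟩, ⟨lam1, h1⟩⟩ := fun_data hfun s13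
  have hs : lam (u ^ 0 * x) ≠ 0 := by rw [hlam 0 (by norm_num)]; exact hs0
  exact shape13.not_boxUseful crit13.1 (lt_q_of_fun hfun) x lam (surjective_of_ne_zero lam _ hs) s13 hlam lam1 h1
    crit13.2.1 crit13.2.2 A13 sep13 big13

/-! ### `p = 19`: shape `ea = (0, 0, 1)`, `eb = (0, 1, 1)`, `m = (7, 1, 6)`, `n = (11, 11, 18)`, `s = (4, 1, 15)`, pattern `40/171` -/

/-- The shape for `p = 19`. [folklore] -/
def shape19 : Shape := ⟨![0, 0, 1], ![0, 1, 1], ![7, 1, 6], ![11, 11, 18]⟩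

/-- The prescribed values `λ (u^e x)`, `e ≤ 2`, for `p = 19`. [folklore] -/
def s19 (e : ℕ) : ZMod 19 := if e = 0 then 4 else if e = 1 then 1 else 15

/-- The nine column sets for `p = 19` (total `40`). [folklore] -/
def A19 (c : Fin 3 × Fin 3) : Finset (ZMod 19) :=
  (![![{2, 12, 15, 16}, {0, 5, 6, 15, 18}, {5, 9, 10, 14, 15}], ![{3, 8, 9, 12}, {0, 1, 10, 15, 16}, {0, 6, 7, 10}], ![{9, 13}, {8, 12, 13, 14, 18}, {1, 5, 6, 7, 10, 11}]] : Fin 3 → Fin 3 → Finset (ZMod 19)) c.1 c.2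

/-- Separation for `p = 19` (by `decide`). [folklore] -/
theorem sep19 : ∀ c c' : Fin 3 × Fin 3, c ≠ c' → ∀ z ∈ A19 c, ∀ z' ∈ A19 c', z - z' ≠ shape19.delta s19 c c' := by
  decide +kernel

/-- Count for `p = 19`: `9·19 ≤ 5·40`. [folklore] -/
theorem big19 : 9 * Fintype.card (ZMod 19) ≤ 5 * ∑ c, #(A19 c) := by
  rw [ZMod.card]; decide +kernel

/-- Exponent bound and separating criterion of the shape for `p = 19` (by `decide`). [folklore] -/
theorem crit19 : (∀ i j : Fin 3, shape19.ea i + shape19.eb j ≤ 2) ∧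
    (∀ i i' : Fin 3, i ≠ i' → shape19.ea i ≠ shape19.ea i' ∨ ¬ (19 : ℤ) ∣ shape19.m i - shape19.m i') ∧
    (∀ j j' : Fin 3, j ≠ j' → shape19.eb j ≠ shape19.eb j' ∨ ¬ (19 : ℤ) ∣ shape19.n j - shape19.n j') := by
  decide +kernel

/-- **`p = 19`.** `R ⋊_u ℤ/q` is not box-useful whenever `x, u x, u² x` carry every prescribed additive `𝔽_19`-valued functional.
[folklore] -/
theorem not_boxUseful_19 (x : R) (hfun : ∀ t : ℕ → ZMod 19, ∃ lam : R →+ ZMod 19, ∀ e, e ≤ 2 → lam (u ^ e * x) = t e) :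
    ¬ BoxUseful (RCyc R q u) := by
  have hs0 : s19 0 ≠ 0 := by decide
  haveI : Fact (Nat.Prime 19) := ⟨by norm_num⟩
  obtain ⟨⟨lam, hlam⟩, ⟨lam1, h1⟩⟩ := fun_data hfun s19
  have hs : lam (u ^ 0 * x) ≠ 0 := by rw [hlam 0 (by norm_num)]; exact hs0
  exact shape19.not_boxUseful crit19.1 (lt_q_of_fun hfun) x lam (surjective_of_ne_zero lam _ hs) s19 hlam lam1 h1
    crit19.2.1 crit19.2.2 A19 sep19 big19

/-! ### `p = 2`: four prescribed powers, `P = 𝔽_2²`; shape `ea = (2, 0, 0)`, `eb = (1, 0, 1)`, `m = (1, 0, 1)`, `n = (1, 1, 0)`, pattern `8/36` -/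

/-- The shape for `p = 2`. [folklore] -/
def shape2 : Shape := ⟨![2, 0, 0], ![1, 0, 1], ![1, 0, 1], ![1, 1, 0]⟩

/-- The prescribed values `λ (u^e x) ∈ 𝔽_2²`, `e ≤ 3`, for `p = 2`: `(0,0), (1,0), (1,1), (0,1)`. [folklore] -/
def s2 (e : ℕ) : Fin 2 → ZMod 2 := if e = 0 then ![0, 0] else if e = 1 then ![1, 0] else if e = 2 then ![1, 1] else ![0, 1]

/-- The nine column sets for `p = 2` (total `8` of `36`). [folklore] -/
def A2 (c : Fin 3 × Fin 3) : Finset (Fin 2 → ZMod 2) :=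
  (![![{![0, 0]}, {![0, 0]}, {![0, 0]}], ![{![0, 1]}, ∅, {![0, 1]}], ![{![0, 0]}, {![0, 0]}, {![0, 0]}]] : Fin 3 → Fin 3 → Finset (Fin 2 → ZMod 2)) c.1 c.2

/-- Separation for `p = 2` (by `decide`). [folklore] -/
theorem sep2 : ∀ c c' : Fin 3 × Fin 3, c ≠ c' → ∀ z ∈ A2 c, ∀ z' ∈ A2 c', z - z' ≠ shape2.delta s2 c c' := by
  decide +kernel

/-- Count for `p = 2`: `9·4 ≤ 5·8`. [folklore] -/
theorem big2 : 9 * Fintype.card (Fin 2 → ZMod 2) ≤ 5 * ∑ c, #(A2 c) := by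
  decide +kernel

/-- Exponent bound and separating criterion of the shape for `p = 2` (by `decide`). [folklore] -/
theorem crit2 : (∀ i j : Fin 3, shape2.ea i + shape2.eb j ≤ 3) ∧
    (∀ i i' : Fin 3, i ≠ i' → shape2.ea i ≠ shape2.ea i' ∨ ¬ (2 : ℤ) ∣ shape2.m i - shape2.m i') ∧
    (∀ j j' : Fin 3, j ≠ j' → shape2.eb j ≠ shape2.eb j' ∨ ¬ (2 : ℤ) ∣ shape2.n j - shape2.n j') := by
  decide +kernel

/-- **`p = 2`.** `R ⋊_u ℤ/q` is not box-useful whenever `x, u x, u² x, u³ x` carry every prescribed additive `𝔽_2`-valued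
functional (automatic for the atoms `𝔽_{2^k} ⋊ μ_q` with `k = ord_q 2 ≥ 4`, i.e. every prime `q ≥ 5` except `q = 7`). [folklore] -/
theorem not_boxUseful_2 (x : R) (hfun : ∀ t : ℕ → ZMod 2, ∃ lam : R →+ ZMod 2, ∀ e, e ≤ 3 → lam (u ^ e * x) = t e) :
    ¬ BoxUseful (RCyc R q u) := by
  haveI : Fact (Nat.Prime 2) := ⟨by norm_num⟩
  choose lamk hlamk using fun k : Fin 2 => hfun (fun e => s2 e k)
  obtain ⟨lam1, h1⟩ := (fun_data hfun (fun _ => 0)).2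
  let Lam : R →+ (Fin 2 → ZMod 2) := AddMonoidHom.pi lamk
  have hLam : ∀ e, e ≤ 3 → Lam (u ^ e * x) = s2 e := fun e he => funext fun k => hlamk k e he
  have hsurj : Function.Surjective Lam := by
    intro v
    refine ⟨(((v 0).val : ℕ) : R) * (u ^ 1 * x) + (((v 1).val : ℕ) : R) * (u ^ 3 * x), ?_⟩
    rw [map_add, ← nsmul_eq_mul, ← nsmul_eq_mul, map_nsmul, map_nsmul, hLam 1 (by norm_num), hLam 3 (by norm_num)]
    funext k
    fin_cases k <;> simp [s2, nsmul_eq_mul]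
  exact shape2.not_boxUseful crit2.1 (lt_q_of_fun hfun) x Lam hsurj s2 hLam lam1 h1 crit2.2.1 crit2.2.2 A2 sep2 big2

end PowBox

end Summit.MatrixMultiplication.OmegaCensus
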